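import Mathlib.RingTheory.MvPolynomial.Homogeneous
import Mathlib.Algebra.MvPolynomial.Degrees
import HarnessLib

/-!
# Dehomogenization of forms: killing one variable is injective in fixed degree

Topic: `Literature/AlgebraicGeometry/Resolution`. Elementary bookkeeping on polynomial rings for
the charts of the blowing up of a point ([CoP1] = Cossart–Piltant, J. Algebra 320 (2008), proof
of Prop. 4.2, (11): "in the chart of `X′` where, say `y₁′ := y₁` is an equation of the
exceptional divisor, `y₁^{-μ} f ≡ F(1, y₂′, y₃′) mod (y₁′)`"): the exceptional divisor of the
chart `D₊(T_i)` is the affine space `Spec k[T_j : j ≠ i]`, and the restriction to it of the weak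
transform of `f` is the DEHOMOGENIZATION `F(…, T_i := 1, …)` of the initial form `F` of `f`. To
bound its order by `deg F` (`TaylorOrderBound.lean`) one needs it NON-ZERO of degree `≤ deg F`:

* `killVar i`, `dehomogenize i = aeval (killVar i) : R[T_σ] → R[T_j : j ≠ i]` (`T_i ↦ 1`; the
  substitution `kill` of `BlowupChartQuasiRegular.lean`, made a definition);
* `dehomogenize_monomial` — `T^α ↦ T^{α|_{j ≠ i}}`; `dehomogenize_eq_sum`;
* `subtypeDomain_injOn_degree` — restriction of exponents `α ↦ α|_{j≠i}` is injective in fixed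
  degree `|α| = n`;
* `coeff_dehomogenize_of_isHomogeneous` — **for a form `F` of degree `n`, the coefficients of
  its dehomogenization are those of `F`**; hence `dehomogenize_ne_zero_of_isHomogeneous`
  (**dehomogenization is injective on forms**);
* `totalDegree_dehomogenize_le` — `deg F(T_i := 1) ≤ deg F`; `map_dehomogenize` (compatibility
  with change of coefficients).

All [folklore].

Relation to `Literature.AlgebraicGeometry.Motives.dehomogenize`
(`Motives/VarietiesProjectiveSpaceProofs.lean`, `Motives/ProjectiveSpaceDehomogenize.lean`):
that map is `R[x_0, …, x_n] → R[y_1, …, y_n]`, reindexing the surviving variables by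
`Fin.succAbove`, and its injectivity on forms (`eq_of_dehomogenize_eq`) is proved for DOMAINS
via `R[x] ↪ R[x]_{x_i}`. The blow-up chart rings of this topic (`BlowupChartRsop.lean`,
`BlowupChartQuasiRegular.lean`: `chartQuotEquiv : (R/I)[T_j : j ≠ i] ≃ B/(c_i)`) are indexed by
the subtype `{j // j ≠ i}` and use the substitution `kill = killVar i` literally
(`eval₂Hom_comp_aeval_kill`), and the coefficient rings met here (`R/𝔪`, `R`) need not be
domains in the intermediate steps; hence this rendering, indexed by `{j // j ≠ i}` over an
arbitrary commutative ring, with the coefficient formula `coeff_dehomogenize_of_isHomogeneous`.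

## Sources

* V. Cossart, O. Piltant, J. Algebra 320 (2008), proof of Prop. 4.2, (10)–(11), p. 8 (the
  application). [CossartPiltant2008]
-/

noncomputable section

namespace Literature.AlgebraicGeometry.Resolution

open MvPolynomial Finsupp

variable {R : Type*} [CommRing R] {σ : Type*} [DecidableEq σ] (i : σ)

/-- The substitution killing the variable `T_i`: `T_i ↦ 1`, `T_j ↦ T_j` (`j ≠ i`).
[folklore] -/
def killVar : σ → MvPolynomial {j : σ // j ≠ i} R :=
  fun j => if h : j = i then 1 else MvPolynomial.X ⟨j, h⟩

/-- `killVar` at `i`. [folklore] -/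
@[simp] theorem killVar_self : killVar (R := R) i i = 1 := dif_pos rfl

/-- `killVar` off `i`. [folklore] -/
theorem killVar_of_ne {j : σ} (h : j ≠ i) : killVar (R := R) i j = MvPolynomial.X ⟨j, h⟩ :=
  dif_neg h

/-- **Dehomogenization** `F ↦ F(T_i := 1)`: `R[T_σ] → R[T_j : j ≠ i]`. [folklore] -/
abbrev dehomogenize : MvPolynomial σ R →ₐ[R] MvPolynomial {j : σ // j ≠ i} R :=
  MvPolynomial.aeval (killVar i)

/-- The exponent products: `∏_j (killVar i j)^{α_j} = T^{α|_{j ≠ i}}`. [folklore] -/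
theorem prod_killVar_pow (α : σ →₀ ℕ) :
    (α.prod fun j k => killVar (R := R) i j ^ k) =
      (α.subtypeDomain (· ≠ i)).prod fun j k => MvPolynomial.X j ^ k := by
  classical
  -- right-hand side as a product over `α.support` filtered by `j ≠ i`
  have hr : ((α.subtypeDomain (· ≠ i)).prod fun j k => MvPolynomial.X (R := R) j ^ k) =
      ∏ j ∈ α.support with j ≠ i, killVar (R := R) i j ^ α j := by
    rw [Finsupp.prod, Finsupp.support_subtypeDomain, ← Finset.prod_subtype_eq_prod_filter
      (fun j => killVar (R := R) i j ^ α j)]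
    refine Finset.prod_congr rfl fun j _ => ?_
    rw [Finsupp.subtypeDomain_apply, killVar_of_ne i j.2]
  rw [hr, Finsupp.prod, ← Finset.prod_filter_mul_prod_filter_not α.support (fun j => j ≠ i)]
  have h1 : ∏ j ∈ α.support with ¬ (j ≠ i), killVar (R := R) i j ^ α j = 1 := by
    refine Finset.prod_eq_one fun j hj => ?_
    rw [Finset.mem_filter, not_ne_iff] at hj
    rw [hj.2, killVar_self, one_pow]
  rw [h1, mul_one]

/-- **Dehomogenizing a monomial**: `c T^α ↦ c T^{α|_{j ≠ i}}`. [folklore] -/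
theorem dehomogenize_monomial (α : σ →₀ ℕ) (c : R) :
    dehomogenize i (monomial α c) = monomial (α.subtypeDomain (· ≠ i)) c := by
  rw [MvPolynomial.aeval_monomial, prod_killVar_pow, MvPolynomial.algebraMap_eq,
    ← MvPolynomial.monomial_eq]

/-- Dehomogenization as a sum over the support. [folklore] -/
theorem dehomogenize_eq_sum (F : MvPolynomial σ R) :
    dehomogenize i F = ∑ α ∈ F.support, monomial (α.subtypeDomain (· ≠ i)) (coeff α F) := by
  conv_lhs => rw [F.as_sum]
  rw [map_sum]
  exact Finset.sum_congr rfl fun α _ => dehomogenize_monomial i α _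

omit [CommRing R] [DecidableEq σ] in
/-- **Restriction of exponents is injective in fixed degree**: `α|_{j≠i} = β|_{j≠i}` and
`|α| = |β|` force `α = β` (the `i`-th exponent is `|α| - ∑_{j≠i} α_j`). [folklore] -/
theorem subtypeDomain_injOn_degree [DecidableEq σ] (n : ℕ) :
    Set.InjOn (fun α : σ →₀ ℕ => α.subtypeDomain (· ≠ i)) {α | degree α = n} := by
  intro α hα β hβ h
  simp only [Set.mem_setOf_eq] at hα hβ
  have he : α.erase i = β.erase i := by
    ext j
    by_cases hj : j = i
    · rw [hj, Finsupp.erase_same, Finsupp.erase_same]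
    · rw [Finsupp.erase_ne hj, Finsupp.erase_ne hj]
      have := DFunLike.congr_fun h ⟨j, hj⟩
      rwa [Finsupp.subtypeDomain_apply, Finsupp.subtypeDomain_apply] at this
  have hαi : degree (α.erase i) + α i = n := by
    rw [← degree_single i (α i), ← map_add, Finsupp.erase_add_single, hα]
  have hβi : degree (β.erase i) + β i = n := by
    rw [← degree_single i (β i), ← map_add, Finsupp.erase_add_single, hβ]
  have hi : α i = β i := by rw [he] at hαi; omega
  rw [← Finsupp.erase_add_single i α, ← Finsupp.erase_add_single i β, he, hi]

/-- **The coefficients of the dehomogenization of a form are those of the form.** [folklore] -/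
theorem coeff_dehomogenize_of_isHomogeneous {F : MvPolynomial σ R} {n : ℕ}
    (hF : F.IsHomogeneous n) {α : σ →₀ ℕ} (hα : degree α = n) :
    coeff (α.subtypeDomain (· ≠ i)) (dehomogenize i F) = coeff α F := by
  classical
  rw [dehomogenize_eq_sum, coeff_sum]
  simp only [coeff_monomial]
  rw [Finset.sum_eq_single α]
  · rw [if_pos rfl]
  · intro β hβ hne
    rw [if_neg]
    intro h
    have hβn : degree β = n := by
      by_contra hβn
      exact (MvPolynomial.mem_support_iff.mp hβ) (hF.coeff_eq_zero hβn)
    exact hne (subtypeDomain_injOn_degree i n hβn hα h)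
  · intro hα'
    rw [if_pos rfl]
    exact MvPolynomial.notMem_support_iff.mp hα'

/-- **Dehomogenization is injective on forms.** [folklore] -/
theorem dehomogenize_ne_zero_of_isHomogeneous {F : MvPolynomial σ R} {n : ℕ}
    (hF : F.IsHomogeneous n) (h : F ≠ 0) : dehomogenize i F ≠ 0 := by
  obtain ⟨α, hα⟩ := MvPolynomial.ne_zero_iff.mp h
  have hαn : degree α = n := by
    by_contra hαn
    exact hα (hF.coeff_eq_zero hαn)
  rw [MvPolynomial.ne_zero_iff]
  exact ⟨α.subtypeDomain (· ≠ i), by rwa [coeff_dehomogenize_of_isHomogeneous i hF hαn]⟩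

omit [CommRing R] [DecidableEq σ] in
/-- Restricting exponents does not increase the degree. [folklore] -/
theorem degree_subtypeDomain_le [DecidableEq σ] (α : σ →₀ ℕ) :
    degree (α.subtypeDomain (· ≠ i)) ≤ degree α := by
  classical
  rw [degree_apply, degree_apply, Finsupp.support_subtypeDomain]
  simp only [Finsupp.subtypeDomain_apply]
  rw [Finset.sum_subtype_eq_sum_filter (fun j => α j)]
  exact Finset.sum_le_sum_of_subset (Finset.filter_subset _ _)

/-- **`deg F(T_i := 1) ≤ deg F`.** [folklore] -/
theorem totalDegree_dehomogenize_le (F : MvPolynomial σ R) :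
    (dehomogenize i F).totalDegree ≤ F.totalDegree := by
  classical
  rw [dehomogenize_eq_sum]
  refine (MvPolynomial.totalDegree_finsetSum _ _).trans (Finset.sup_le fun α hα => ?_)
  refine (MvPolynomial.totalDegree_monomial_le _ _).trans ?_
  exact (degree_subtypeDomain_le i α).trans (MvPolynomial.le_totalDegree hα)

/-- **Change of coefficients commutes with dehomogenization.** [folklore] -/
theorem map_dehomogenize {S : Type*} [CommRing S] (f : R →+* S) (F : MvPolynomial σ R) :
    MvPolynomial.map f (dehomogenize i F) = dehomogenize i (MvPolynomial.map f F) := by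
  have : (MvPolynomial.map f).comp (dehomogenize (R := R) i).toRingHom =
      (dehomogenize (R := S) i).toRingHom.comp (MvPolynomial.map f) := by
    refine MvPolynomial.ringHom_ext (fun a => ?_) (fun j => ?_)
    · simp
    · by_cases h : j = i
      · subst h
        simp [killVar]
      · simp [killVar, h]
  exact RingHom.congr_fun this F

end Literature.AlgebraicGeometry.Resolution

end
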